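import Mathlib
import Literature.Analysis.PDE.Wave1DExteriorEnergy
import Summits.FinalStateConjecture.FinalStateConjecture.Theorems.PhotonSphereChannelsRWPotential

/-!
# Route PhotonSphereChannels — `FixedModeChannels` reduces to two half-line channel estimates

Item stmt-FinalStateConjecture-10048 (`FixedModeChannels`): the per-mode two-ended exterior channel
inequality for the Regge–Wheeler family. The exterior region `{ρ + |t| < |x − xc|}` of the excised
ball is the DISJOINT union of the far component `{xc + ρ + |t| < x}` (towards null infinity) and the
near component `{x < xc − ρ − |t|}` (towards the horizon); the cone `Ω` and the kernel `P(ρ)`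
(t-polynomial `C²` solutions on `Ω`) split accordingly. The main theorem
`fixedModeChannels_of_near_far` proves

  `NearHalfLineChannels → FarHalfLineChannels → FixedModeChannels`

where the two hypotheses are VERBATIM the statement of `FixedModeChannels` with the exterior region,
the cone and the kernel replaced by their near (resp. far) components, and the conclusion is
VERBATIM the body of the route decl
`Summit.FinalStateConjecture.FinalStateConjecture.Theses.PhotonSphereChannels.FixedModeChannels`
(checked: `example (hn) (hf) : …Theses.PhotonSphereChannels.FixedModeChannels := by exact
fixedModeChannels_of_near_far hn hf` elaborates). The file does not import the route module on
purpose (a closing module must stay importable by the gate-rendered route file).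

Ingredients: `ρ₀ = max`, `c = min`; product structure of the kernel (glue
`if x ≤ xc then p_near else p_far`, which is `C²`, solves and is t-polynomial on each open
component — derivatives are local); the exterior energy is `E_far + E_near`, each non-increasing
in `|t|` (`Literature.Analysis.PDE.wave1D_farEnergy_mono_of_nonneg` & co., finite speed of
propagation), so `liminf E_far + liminf E_near ≤ liminf Eext` at `±∞` (for monotone `ℝ≥0∞`-valued
functions `liminf` is an infimum); `V ≥ 0` from `rwPotential_nonneg`.

What remains for the item (see the blueprint attached to stmt-FinalStateConjecture-10048):
NEAR — recessive static mode + Hardy + d'Alembert comparison + Duhamel (from scratch);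
FAR — Kenig–Lawrie–Liu–Schlag odd-dimensional channels (`d = 2ℓ + 3`) + perturbation.
-/

namespace Summit.FinalStateConjecture.FinalStateConjecture.Theorems

open MeasureTheory Set Filter Topology Literature.Analysis.PDE
open scoped ENNReal

/-! ### `liminf` of monotone `ℝ≥0∞`-valued functions -/

/-- For `u` non-increasing on `[0, ∞)`, `liminf_{+∞} u ≤ u t` for every `t ≥ 0`. -/
theorem liminf_atTop_le_of_antitoneOn {u : ℝ → ℝ≥0∞} (hu : AntitoneOn u (Ici 0)) {t : ℝ}
    (ht : 0 ≤ t) : liminf u atTop ≤ u t := by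
  refine Filter.liminf_le_of_frequently_le' (Eventually.frequently ?_)
  filter_upwards [eventually_ge_atTop t] with t' ht'
  exact hu ht (ht.trans ht') ht'

/-- For `u` non-decreasing on `(−∞, 0]`, `liminf_{−∞} u ≤ u t` for every `t ≤ 0`. -/
theorem liminf_atBot_le_of_monotoneOn {u : ℝ → ℝ≥0∞} (hu : MonotoneOn u (Iic 0)) {t : ℝ}
    (ht : t ≤ 0) : liminf u atBot ≤ u t := by
  refine Filter.liminf_le_of_frequently_le' (Eventually.frequently ?_)
  filter_upwards [eventually_le_atBot t] with t' ht'
  exact hu (ht'.trans ht) ht ht'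

/-- `liminf` is super-additive along `+∞` for non-increasing `ℝ≥0∞`-valued functions on `[0, ∞)`
(both sides are then infima). -/
theorem add_liminf_le_liminf_add_of_antitoneOn {u v : ℝ → ℝ≥0∞} (hu : AntitoneOn u (Ici 0))
    (hv : AntitoneOn v (Ici 0)) :
    liminf u atTop + liminf v atTop ≤ liminf (fun t => u t + v t) atTop := by
  refine le_trans ?_ (Filter.le_liminf_of_le (by isBoundedDefault)
    ((eventually_ge_atTop (0 : ℝ)).mono fun t ht => biInf_le (fun t => u t + v t) ht))
  exact le_iInf₂ fun t ht =>
    add_le_add (liminf_atTop_le_of_antitoneOn hu ht) (liminf_atTop_le_of_antitoneOn hv ht)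

/-- `liminf` is super-additive along `−∞` for non-decreasing `ℝ≥0∞`-valued functions on `(−∞, 0]`. -/
theorem add_liminf_le_liminf_add_of_monotoneOn {u v : ℝ → ℝ≥0∞} (hu : MonotoneOn u (Iic 0))
    (hv : MonotoneOn v (Iic 0)) :
    liminf u atBot + liminf v atBot ≤ liminf (fun t => u t + v t) atBot := by
  refine le_trans ?_ (Filter.le_liminf_of_le (by isBoundedDefault)
    ((eventually_le_atBot (0 : ℝ)).mono fun t ht => biInf_le (fun t => u t + v t) ht))
  exact le_iInf₂ fun t ht =>
    add_le_add (liminf_atBot_le_of_monotoneOn hu ht) (liminf_atBot_le_of_monotoneOn hv ht)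

/-! ### The reduction -/

/-- **`FixedModeChannels` follows from the two half-line channel estimates.** Hypotheses: the FAR
(null-infinity side) and NEAR (horizon side) per-mode channel inequalities — verbatim the statement of
`FixedModeChannels` (item stmt-FinalStateConjecture-10048 of route PhotonSphereChannels) with the exterior
region `{ρ + |t| < |x − xc|}` replaced by its right component `{xc + ρ + |t| < x}` (resp. left component
`{x < xc − ρ − |t|}`), the cone and the t-polynomial kernel `P` restricted accordingly. Conclusion:
verbatim the body of `FixedModeChannels` (so that this theorem, fed with proofs of the two hypotheses,
closes the item by `δ`-unfolding; the file deliberately does not import the route module).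
Proof: `ρ₀ = max`, `c = min`; the kernel on the two-component cone is the product of the one-sided
kernels (glue `p = if x ≤ xc then p_near else p_far`: `C²`, a solution and t-polynomial on each open
component), so `⨅_P E[ψ − p] ≤ ⨅_{P_far} E_far[ψ − p] + ⨅_{P_near} E_near[ψ − p]`; the exterior energy
splits as `E_far + E_near`, each non-increasing in `|t|` by finite speed of propagation
(`Literature.Analysis.PDE.wave1D_farEnergy_mono_of_nonneg` etc.), whence
`liminf E_far + liminf E_near ≤ liminf Eext` at `±∞`. -/
theorem fixedModeChannels_of_near_far
    (hnear : ∀ M : ℝ, 0 < M → ∀ (s ℓ : ℕ), s ≤ 2 → s ≤ ℓ → ∃ ρ₀ : ℝ, 0 ≤ ρ₀ ∧ ∃ c : ℝ, 0 < c ∧ ∀ (r : ℝ → ℝ) (xc : ℝ), (∀ x, 2 * M < r x) → (∀ x, HasDerivAt r (1 - 2 * M / r x) x) → r xc = 3 * M → ∀ ρ : ℝ, ρ₀ ≤ ρ → ∀ ψ : ℝ → ℝ → ℝ, ContDiff ℝ 2 (Function.uncurry ψ) → let V : ℝ → ℝ := fun x => (1 - 2 * M / r x) * ((ℓ : ℝ)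 * ((ℓ : ℝ) + 1) / r x ^ 2 + (1 - (s : ℝ) ^ 2) * (2 * M) / r x ^ 3); let e : (ℝ → ℝ → ℝ) → ℝ → ℝ → ℝ := fun φ t x => deriv (fun τ => φ τ x) t ^ 2 + deriv (φ t) x ^ 2 + V x * φ t x ^ 2; let IsSol : (ℝ → ℝ → ℝ) → ℝ × ℝ → Prop := fun φ z => iteratedDeriv 2 (fun τ => φ τ z.2) z.1 - iteratedDeriv 2 (φ z.1) z.2 + V z.2 * φ z.1 z.2 = 0; let Ω : Set (ℝ × ℝ) := {z | z.2 < xc - ρ - |z.1|}; let P : Set (ℝ → ℝ → ℝ) := {p | ContDiffOn ℝ 2 (Function.uncurry p) Ω ∧ (∀ z ∈ Ω, IsSol p z) ∧ ∃ (N : ℕ) (a : ℕ → ℝ → ℝ), ∀ z ∈ Ω, p z.1 z.2 = ∑ i ∈ Finset.range N, a i z.2 * z.1 ^ i}; let Eext : ℝ → ENNReal := fun t => MeasureTheory.lintegral (MeasureTheory.volume.restrict (Set.Iio (xc - ρ - |t|))) (fun x => ENNReal.ofReal (e ψ t x)); (∀ z, IsSol ψ z) → ENNReal.ofReal c * (⨅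 p ∈ P, MeasureTheory.lintegral (MeasureTheory.volume.restrict (Set.Iio (xc - ρ))) (fun x => ENNReal.ofReal (e (fun t y => ψ t y - p t y) 0 x))) ≤ Filter.liminf Eext Filter.atTop + Filter.liminf Eext Filter.atBot)
    (hfar : ∀ M : ℝ, 0 < M → ∀ (s ℓ : ℕ), s ≤ 2 → s ≤ ℓ → ∃ ρ₀ : ℝ, 0 ≤ ρ₀ ∧ ∃ c : ℝ, 0 < c ∧ ∀ (r : ℝ → ℝ) (xc : ℝ), (∀ x, 2 * M < r x) → (∀ x, HasDerivAt r (1 - 2 * M / r x) x) → r xc = 3 * M → ∀ ρ : ℝ, ρ₀ ≤ ρ → ∀ ψ : ℝ → ℝ → ℝ, ContDiff ℝ 2 (Function.uncurry ψ) → let V : ℝ → ℝ := fun x => (1 - 2 * M / r x) * ((ℓ : ℝ) * ((ℓ : ℝ) + 1) / r x ^ 2 + (1 - (s : ℝ) ^ 2) * (2 * M) / r x ^ 3); let e : (ℝ → ℝ → ℝ) → ℝ → ℝ → ℝ := fun φ t x => deriv (fun τ => φ τ x) t ^ 2 + deriv (φ t) x ^ 2 + V x * φ t x ^ 2; let IsSol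 : (ℝ → ℝ → ℝ) → ℝ × ℝ → Prop := fun φ z => iteratedDeriv 2 (fun τ => φ τ z.2) z.1 - iteratedDeriv 2 (φ z.1) z.2 + V z.2 * φ z.1 z.2 = 0; let Ω : Set (ℝ × ℝ) := {z | xc + ρ + |z.1| < z.2}; let P : Set (ℝ → ℝ → ℝ) := {p | ContDiffOn ℝ 2 (Function.uncurry p) Ω ∧ (∀ z ∈ Ω, IsSol p z) ∧ ∃ (N : ℕ) (a : ℕ → ℝ → ℝ), ∀ z ∈ Ω, p z.1 z.2 = ∑ i ∈ Finset.range N, a i z.2 * z.1 ^ i}; let Eext : ℝ → ENNReal := fun t => MeasureTheory.lintegral (MeasureTheory.volume.restrict (Set.Ioi (xc + ρ + |t|))) (fun x => ENNReal.ofReal (e ψ t x)); (∀ z, IsSol ψ z) → ENNReal.ofReal c * (⨅ p ∈ P, MeasureTheory.lintegral (MeasureTheory.volume.restrict (Set.Ioi (xc + ρ))) (fun x => ENNReal.ofReal (e (fun t y => ψ t y - p t y) 0 x))) ≤ Filter.liminf Eext Filter.atTop + Filter.liminf Eext Filter.atBot) :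
    ∀ M : ℝ, 0 < M → ∀ (s ℓ : ℕ), s ≤ 2 → s ≤ ℓ → ∃ ρ₀ : ℝ, 0 ≤ ρ₀ ∧ ∃ c : ℝ, 0 < c ∧ ∀ (r : ℝ → ℝ) (xc : ℝ), (∀ x, 2 * M < r x) → (∀ x, HasDerivAt r (1 - 2 * M / r x) x) → r xc = 3 * M → ∀ ρ : ℝ, ρ₀ ≤ ρ → ∀ ψ : ℝ → ℝ → ℝ, ContDiff ℝ 2 (Function.uncurry ψ) → let V : ℝ → ℝ := fun x => (1 - 2 * M / r x) * ((ℓ : ℝ) * ((ℓ : ℝ) + 1) / r x ^ 2 + (1 - (s : ℝ) ^ 2) * (2 * M) / r x ^ 3); let e : (ℝ → ℝ → ℝ) → ℝ → ℝ → ℝ := fun φ t x => deriv (fun τ => φ τ x) t ^ 2 + deriv (φ t) x ^ 2 + V x * φ t x ^ 2; let IsSol : (ℝ → ℝ → ℝ) → ℝ × ℝ → Prop := fun φ z => iteratedDeriv 2 (fun τ => φ τ z.2) z.1 - iteratedDeriv 2 (φ z.1) z.2 + V z.2 * φ z.1 z.2 = 0; let Ω : Set (ℝ × ℝ) := {z |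 ρ + |z.1| < |z.2 - xc|}; let P : Set (ℝ → ℝ → ℝ) := {p | ContDiffOn ℝ 2 (Function.uncurry p) Ω ∧ (∀ z ∈ Ω, IsSol p z) ∧ ∃ (N : ℕ) (a : ℕ → ℝ → ℝ), ∀ z ∈ Ω, p z.1 z.2 = ∑ i ∈ Finset.range N, a i z.2 * z.1 ^ i}; let Eext : ℝ → ENNReal := fun t => MeasureTheory.lintegral (MeasureTheory.volume.restrict {x : ℝ | ρ + |t| < |x - xc|}) (fun x => ENNReal.ofReal (e ψ t x)); (∀ z, IsSol ψ z) → ENNReal.ofReal c * (⨅ p ∈ P, MeasureTheory.lintegral (MeasureTheory.volume.restrict {x : ℝ | ρ < |x - xc|}) (fun x => ENNReal.ofReal (e (fun t y => ψ t y - p t y) 0 x))) ≤ Filter.liminf Eext Filter.atTop + Filter.liminf Eext Filter.atBot := by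
  intro M hM s ℓ hs hsℓ
  obtain ⟨ρn, hρn0, cn, hcn, Hn⟩ := hnear M hM s ℓ hs hsℓ
  obtain ⟨ρf, hρf0, cf, hcf, Hf⟩ := hfar M hM s ℓ hs hsℓ
  refine ⟨max ρn ρf, hρn0.trans (le_max_left _ _), min cn cf, lt_min hcn hcf, ?_⟩
  intro r xc hr hr' hxc ρ hρ ψ hψ V e IsSol Ω P Eext hsol
  have hρ0 : 0 ≤ ρ := hρn0.trans ((le_max_left _ _).trans hρ)
  -- the potential: continuity and sign
  have hrc : Continuous r := continuous_iff_continuousAt.2 fun x => (hr' x).continuousAt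
  have hr0 : ∀ x, r x ≠ 0 := fun x => (lt_trans (by positivity) (hr x)).ne'
  have hVc : Continuous V := by
    show Continuous fun x => (1 - 2 * M / r x) * ((ℓ : ℝ) * ((ℓ : ℝ) + 1) / r x ^ 2
      + (1 - (s : ℝ) ^ 2) * (2 * M) / r x ^ 3)
    exact (continuous_const.sub (continuous_const.div hrc hr0)).mul
      ((continuous_const.div (hrc.pow 2) fun x => pow_ne_zero 2 (hr0 x)).add
        (continuous_const.div (hrc.pow 3) fun x => pow_ne_zero 3 (hr0 x)))
  have hV0 : ∀ x, 0 ≤ V x := fun x => rwPotential_nonneg hM (hr x) hs hsℓ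
  have hsol' : ∀ t x, iteratedDeriv 2 (fun τ => ψ τ x) t - iteratedDeriv 2 (ψ t) x + V x * ψ t x = 0 :=
    fun t x => hsol (t, x)
  -- one-sided energies, kernels and initial deviations
  set Ef : ℝ → ℝ≥0∞ := fun t => ∫⁻ x in Ioi (xc + ρ + |t|), ENNReal.ofReal (e ψ t x) with hEf
  set En : ℝ → ℝ≥0∞ := fun t => ∫⁻ x in Iio (xc - ρ - |t|), ENNReal.ofReal (e ψ t x) with hEn
  set Ωf : Set (ℝ × ℝ) := {z | xc + ρ + |z.1| < z.2} with hΩf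
  set Ωn : Set (ℝ × ℝ) := {z | z.2 < xc - ρ - |z.1|} with hΩn
  set Pf : Set (ℝ → ℝ → ℝ) := {p | ContDiffOn ℝ 2 (Function.uncurry p) Ωf ∧ (∀ z ∈ Ωf, IsSol p z) ∧
    ∃ (N : ℕ) (a : ℕ → ℝ → ℝ), ∀ z ∈ Ωf, p z.1 z.2 = ∑ i ∈ Finset.range N, a i z.2 * z.1 ^ i} with hPf
  set Pn : Set (ℝ → ℝ → ℝ) := {p | ContDiffOn ℝ 2 (Function.uncurry p) Ωn ∧ (∀ z ∈ Ωn, IsSol p z) ∧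
    ∃ (N : ℕ) (a : ℕ → ℝ → ℝ), ∀ z ∈ Ωn, p z.1 z.2 = ∑ i ∈ Finset.range N, a i z.2 * z.1 ^ i} with hPn
  set If : (ℝ → ℝ → ℝ) → ℝ≥0∞ := fun p =>
    ∫⁻ x in Ioi (xc + ρ), ENNReal.ofReal (e (fun t y => ψ t y - p t y) 0 x) with hIf
  set In : (ℝ → ℝ → ℝ) → ℝ≥0∞ := fun p =>
    ∫⁻ x in Iio (xc - ρ), ENNReal.ofReal (e (fun t y => ψ t y - p t y) 0 x) with hIn
  set I : (ℝ → ℝ → ℝ) → ℝ≥0∞ := fun p =>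
    ∫⁻ x in {x : ℝ | ρ < |x - xc|}, ENNReal.ofReal (e (fun t y => ψ t y - p t y) 0 x) with hI
  have HF : ENNReal.ofReal cf * (⨅ p ∈ Pf, If p) ≤ liminf Ef atTop + liminf Ef atBot :=
    Hf r xc hr hr' hxc ρ ((le_max_right _ _).trans hρ) ψ hψ hsol
  have HN : ENNReal.ofReal cn * (⨅ p ∈ Pn, In p) ≤ liminf En atTop + liminf En atBot :=
    Hn r xc hr hr' hxc ρ ((le_max_left _ _).trans hρ) ψ hψ hsol
  -- (A) monotonicity of the one-sided energies (finite speed of propagation)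
  have hEf_anti : AntitoneOn Ef (Ici 0) := fun a ha b _ hab =>
    wave1D_farEnergy_mono_of_nonneg (V := V) hVc hV0 hψ hsol' (xc + ρ) ha hab
  have hEf_mono : MonotoneOn Ef (Iic 0) := fun a _ b hb hab =>
    wave1D_farEnergy_mono_of_nonpos (V := V) hVc hV0 hψ hsol' (xc + ρ) hb hab
  have hEn_anti : AntitoneOn En (Ici 0) := fun a ha b _ hab =>
    wave1D_nearEnergy_mono_of_nonneg (V := V) hVc hV0 hψ hsol' (xc - ρ) ha hab
  have hEn_mono : MonotoneOn En (Iic 0) := fun a _ b hb hab =>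
    wave1D_nearEnergy_mono_of_nonpos (V := V) hVc hV0 hψ hsol' (xc - ρ) hb hab
  -- (B) the exterior region splits into the two components
  have hsplit : ∀ u : ℝ, 0 ≤ u →
      {x : ℝ | u < |x - xc|} = Ioi (xc + u) ∪ Iio (xc - u) := by
    intro u hu
    ext x
    simp only [mem_setOf_eq, mem_union, mem_Ioi, mem_Iio]
    constructor
    · intro h
      rcases le_or_gt 0 (x - xc) with hx | hx
      · rw [abs_of_nonneg hx] at h; left; linarith
      · rw [abs_of_neg hx] at h; right; linarith
    · rintro (h | h)
      · exact lt_of_lt_of_le (by linarith) (le_abs_self _)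
      · exact lt_of_lt_of_le (by linarith) (neg_le_abs _)
  have hdisj : ∀ u : ℝ, 0 ≤ u → Disjoint (Ioi (xc + u)) (Iio (xc - u)) := fun u hu =>
    Set.disjoint_left.2 fun x hx hx' => by
      simp only [mem_Ioi, mem_Iio] at hx hx'; linarith
  have hEext : Eext = fun t => Ef t + En t := by
    funext t
    have hu : 0 ≤ ρ + |t| := add_nonneg hρ0 (abs_nonneg t)
    show (∫⁻ x in {x : ℝ | ρ + |t| < |x - xc|}, ENNReal.ofReal (e ψ t x)) = Ef t + En t
    rw [hsplit _ hu, lintegral_union measurableSet_Iio (hdisj _ hu)]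
    simp only [hEf, hEn, add_assoc, sub_sub]
  have htop : liminf Ef atTop + liminf En atTop ≤ liminf Eext atTop := by
    rw [hEext]; exact add_liminf_le_liminf_add_of_antitoneOn hEf_anti hEn_anti
  have hbot : liminf Ef atBot + liminf En atBot ≤ liminf Eext atBot := by
    rw [hEext]; exact add_liminf_le_liminf_add_of_monotoneOn hEf_mono hEn_mono
  -- (C) the kernel is a product: glueing one-sided kernel elements
  have hΩf_open : IsOpen Ωf := isOpen_lt (by fun_prop) continuous_snd
  have hΩn_open : IsOpen Ωn := isOpen_lt continuous_snd (by fun_prop)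
  have hfar_of_mem : ∀ z : ℝ × ℝ, z ∈ Ω → z ∈ Ωf ∨ z ∈ Ωn := by
    intro z hz
    have hz' : ρ + |z.1| < |z.2 - xc| := hz
    rcases le_or_gt 0 (z.2 - xc) with h | h
    · left; rw [abs_of_nonneg h] at hz'; show xc + ρ + |z.1| < z.2; linarith
    · right; rw [abs_of_neg h] at hz'; show z.2 < xc - ρ - |z.1|; linarith
  have key : (⨅ p ∈ P, I p) ≤ (⨅ p ∈ Pf, If p) + (⨅ p ∈ Pn, In p) := by
    simp_rw [ENNReal.iInf_add, ENNReal.add_iInf]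
    refine le_iInf fun pf => le_iInf fun hpf => le_iInf fun pn => le_iInf fun hpn => ?_
    obtain ⟨hpf1, hpf2, Nf, af, hpf3⟩ := hpf
    obtain ⟨hpn1, hpn2, Nn, an, hpn3⟩ := hpn
    set g : ℝ → ℝ → ℝ := fun t x => if x ≤ xc then pn t x else pf t x with hg
    -- local agreement of the glued function with the pieces
    have hg_far : ∀ x, xc < x → ∀ t, g t x = pf t x := fun x hx t => by
      simp only [hg, if_neg (not_le.2 hx)]
    have hg_near : ∀ x, x < xc → ∀ t, g t x = pn t x := fun x hx t => by
      simp only [hg, if_pos hx.le]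
    have hg_far_ev : ∀ t x, xc < x → (g t) =ᶠ[𝓝 x] (pf t) := fun t x hx =>
      (eventually_gt_nhds hx).mono fun y hy => hg_far y hy t
    have hg_near_ev : ∀ t x, x < xc → (g t) =ᶠ[𝓝 x] (pn t) := fun t x hx =>
      (eventually_lt_nhds hx).mono fun y hy => hg_near y hy t
    have hxfar : ∀ z : ℝ × ℝ, z ∈ Ωf → xc < z.2 := fun z hz => by
      have h : xc + ρ + |z.1| < z.2 := hz
      linarith [abs_nonneg z.1]
    have hxnear : ∀ z : ℝ × ℝ, z ∈ Ωn → z.2 < xc := fun z hz => by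
      have h : z.2 < xc - ρ - |z.1| := hz
      linarith [abs_nonneg z.1]
    have hgP : g ∈ P := by
      refine ⟨?_, ?_, ?_⟩
      · -- C² on the two-component cone
        intro z hz
        rcases hfar_of_mem z hz with hzf | hzn
        · have h1 : ContDiffAt ℝ 2 (Function.uncurry pf) z := hpf1.contDiffAt (hΩf_open.mem_nhds hzf)
          have h2 : Function.uncurry g =ᶠ[𝓝 z] Function.uncurry pf := by
            have : ∀ᶠ w : ℝ × ℝ in 𝓝 z, xc < w.2 :=
              (isOpen_lt continuous_const continuous_snd).mem_nhds (hxfar z hzf)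
            exact this.mono fun w hw => hg_far w.2 hw w.1
          exact (h1.congr_of_eventuallyEq h2).contDiffWithinAt
        · have h1 : ContDiffAt ℝ 2 (Function.uncurry pn) z := hpn1.contDiffAt (hΩn_open.mem_nhds hzn)
          have h2 : Function.uncurry g =ᶠ[𝓝 z] Function.uncurry pn := by
            have : ∀ᶠ w : ℝ × ℝ in 𝓝 z, w.2 < xc :=
              (isOpen_lt continuous_snd continuous_const).mem_nhds (hxnear z hzn)
            exact this.mono fun w hw => hg_near w.2 hw w.1
          exact (h1.congr_of_eventuallyEq h2).contDiffWithinAt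
      · -- a solution on the cone
        intro z hz
        rcases hfar_of_mem z hz with hzf | hzn
        · have hsolf : iteratedDeriv 2 (fun τ => pf τ z.2) z.1 - iteratedDeriv 2 (pf z.1) z.2
              + V z.2 * pf z.1 z.2 = 0 := hpf2 z hzf
          show iteratedDeriv 2 (fun τ => g τ z.2) z.1 - iteratedDeriv 2 (g z.1) z.2
              + V z.2 * g z.1 z.2 = 0
          have e1 : (fun τ => g τ z.2) = fun τ => pf τ z.2 := funext (hg_far z.2 (hxfar z hzf))
          rw [e1, (hg_far_ev z.1 z.2 (hxfar z hzf)).iteratedDeriv_eq, hg_far z.2 (hxfar z hzf)]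
          exact hsolf
        · have hsoln : iteratedDeriv 2 (fun τ => pn τ z.2) z.1 - iteratedDeriv 2 (pn z.1) z.2
              + V z.2 * pn z.1 z.2 = 0 := hpn2 z hzn
          show iteratedDeriv 2 (fun τ => g τ z.2) z.1 - iteratedDeriv 2 (g z.1) z.2
              + V z.2 * g z.1 z.2 = 0
          have e1 : (fun τ => g τ z.2) = fun τ => pn τ z.2 := funext (hg_near z.2 (hxnear z hzn))
          rw [e1, (hg_near_ev z.1 z.2 (hxnear z hzn)).iteratedDeriv_eq, hg_near z.2 (hxnear z hzn)]
          exact hsoln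
      · -- polynomial in `t` on the cone
        refine ⟨Nf + Nn, fun i x => if x ≤ xc then (if i < Nn then an i x else 0)
          else (if i < Nf then af i x else 0), ?_⟩
        intro z hz
        rcases hfar_of_mem z hz with hzf | hzn
        · have hx := hxfar z hzf
          calc g z.1 z.2 = pf z.1 z.2 := hg_far z.2 hx z.1
            _ = ∑ i ∈ Finset.range Nf, af i z.2 * z.1 ^ i := hpf3 z hzf
            _ = ∑ i ∈ Finset.range Nf, (if i < Nf then af i z.2 else 0) * z.1 ^ i :=
                Finset.sum_congr rfl fun i hi => by rw [if_pos (Finset.mem_range.1 hi)]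
            _ = ∑ i ∈ Finset.range (Nf + Nn), (if i < Nf then af i z.2 else 0) * z.1 ^ i := by
                refine Finset.sum_subset (Finset.range_subset_range.2 (Nat.le_add_right _ _)) ?_
                intro i _ hi
                rw [if_neg (fun h => hi (Finset.mem_range.2 h)), zero_mul]
            _ = _ := Finset.sum_congr rfl fun i _ => by simp only [if_neg (not_le.2 hx)]
        · have hx := hxnear z hzn
          calc g z.1 z.2 = pn z.1 z.2 := hg_near z.2 hx z.1
            _ = ∑ i ∈ Finset.range Nn, an i z.2 * z.1 ^ i := hpn3 z hzn
            _ = ∑ i ∈ Finset.range Nn, (if i < Nn then an i z.2 else 0) * z.1 ^ i :=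
                Finset.sum_congr rfl fun i hi => by rw [if_pos (Finset.mem_range.1 hi)]
            _ = ∑ i ∈ Finset.range (Nf + Nn), (if i < Nn then an i z.2 else 0) * z.1 ^ i := by
                refine Finset.sum_subset (Finset.range_subset_range.2 (Nat.le_add_left _ _)) ?_
                intro i _ hi
                rw [if_neg (fun h => hi (Finset.mem_range.2 h)), zero_mul]
            _ = _ := Finset.sum_congr rfl fun i _ => by simp only [if_pos hx.le]
    -- the initial deviation energy of the glued element splits
    have hIg : I g = If pf + In pn := by
      have hfar_int : EqOn (fun x => ENNReal.ofReal (e (fun t y => ψ t y - g t y) 0 x))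
          (fun x => ENNReal.ofReal (e (fun t y => ψ t y - pf t y) 0 x)) (Ioi (xc + ρ)) := by
        intro x hx
        have hx' : xc < x := by have h : xc + ρ < x := hx; linarith
        show ENNReal.ofReal (deriv (fun τ => ψ τ x - g τ x) 0 ^ 2
            + deriv (fun y => ψ 0 y - g 0 y) x ^ 2 + V x * (ψ 0 x - g 0 x) ^ 2)
          = ENNReal.ofReal (deriv (fun τ => ψ τ x - pf τ x) 0 ^ 2
            + deriv (fun y => ψ 0 y - pf 0 y) x ^ 2 + V x * (ψ 0 x - pf 0 x) ^ 2)
        have e1 : (fun τ => ψ τ x - g τ x) = fun τ => ψ τ x - pf τ x :=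
          funext fun τ => by rw [hg_far x hx' τ]
        have e2 : (fun y => ψ 0 y - g 0 y) =ᶠ[𝓝 x] fun y => ψ 0 y - pf 0 y :=
          (hg_far_ev 0 x hx').mono fun y hy => by simp only [hy]
        rw [e1, e2.deriv_eq, hg_far x hx' 0]
      have hnear_int : EqOn (fun x => ENNReal.ofReal (e (fun t y => ψ t y - g t y) 0 x))
          (fun x => ENNReal.ofReal (e (fun t y => ψ t y - pn t y) 0 x)) (Iio (xc - ρ)) := by
        intro x hx
        have hx' : x < xc := by have h : x < xc - ρ := hx; linarith
        show ENNReal.ofReal (deriv (fun τ => ψ τ x - g τ x) 0 ^ 2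
            + deriv (fun y => ψ 0 y - g 0 y) x ^ 2 + V x * (ψ 0 x - g 0 x) ^ 2)
          = ENNReal.ofReal (deriv (fun τ => ψ τ x - pn τ x) 0 ^ 2
            + deriv (fun y => ψ 0 y - pn 0 y) x ^ 2 + V x * (ψ 0 x - pn 0 x) ^ 2)
        have e1 : (fun τ => ψ τ x - g τ x) = fun τ => ψ τ x - pn τ x :=
          funext fun τ => by rw [hg_near x hx' τ]
        have e2 : (fun y => ψ 0 y - g 0 y) =ᶠ[𝓝 x] fun y => ψ 0 y - pn 0 y :=
          (hg_near_ev 0 x hx').mono fun y hy => by simp only [hy]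
        rw [e1, e2.deriv_eq, hg_near x hx' 0]
      show (∫⁻ x in {x : ℝ | ρ < |x - xc|}, ENNReal.ofReal (e (fun t y => ψ t y - g t y) 0 x))
        = If pf + In pn
      rw [hsplit ρ hρ0, lintegral_union measurableSet_Iio (hdisj ρ hρ0),
        setLIntegral_congr_fun measurableSet_Ioi hfar_int,
        setLIntegral_congr_fun measurableSet_Iio hnear_int]
    calc (⨅ p ∈ P, I p) ≤ I g := biInf_le I hgP
      _ = If pf + In pn := hIg
  -- (D) assemble
  show ENNReal.ofReal (min cn cf) * (⨅ p ∈ P, I p) ≤ liminf Eext atTop + liminf Eext atBot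
  calc ENNReal.ofReal (min cn cf) * (⨅ p ∈ P, I p)
      ≤ ENNReal.ofReal (min cn cf) * ((⨅ p ∈ Pf, If p) + (⨅ p ∈ Pn, In p)) := by gcongr
    _ = ENNReal.ofReal (min cn cf) * (⨅ p ∈ Pf, If p)
        + ENNReal.ofReal (min cn cf) * (⨅ p ∈ Pn, In p) := mul_add _ _ _
    _ ≤ ENNReal.ofReal cf * (⨅ p ∈ Pf, If p) + ENNReal.ofReal cn * (⨅ p ∈ Pn, In p) := by
        gcongr
        · exact min_le_right _ _
        · exact min_le_left _ _
    _ ≤ (liminf Ef atTop + liminf Ef atBot) + (liminf En atTop + liminf En atBot) := add_le_add HF HN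
    _ = (liminf Ef atTop + liminf En atTop) + (liminf Ef atBot + liminf En atBot) :=
        add_add_add_comm _ _ _ _
    _ ≤ liminf Eext atTop + liminf Eext atBot := add_le_add htop hbot

end Summit.FinalStateConjecture.FinalStateConjecture.Theorems
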